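import Summits.QuantumAdvantage.QuantumAdvantage.Theorems.CharDialTransferDialB
import Summits.QuantumAdvantage.QuantumAdvantage.Theorems.CharDialShearDialB
import HarnessLib

/-!
# TransferDial C — the statements (piece B, the field core PF, the residual `PartnersTwoOdd` and its costumes) and the kernel junctions

`StructureLawTwoOdd` (= lens-6 g20 piece B verbatim), `FieldCorePerPrime` (PF, g21/g22), `Sw`, `FewTypesAt`, `FewTypesTwoOdd`,
`FewTypesRung`, `PartnersAt`, `PartnersTwoOdd`, `LocalToGlobalTwoOdd`, `FormsFromFewTwoOdd`, `TransferTwoOdd`, `TransferOfFieldCore`;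
kernel: `closes : FormsFromFewTwoOdd → LocalToGlobalTwoOdd → PartnersTwoOdd → StructureLawTwoOdd`, the exact converse
`pieces_of_structureLaw`, the degree ladder, and `rung_zero : FewTypesRung 0` (unconditional, from the tree's
`ShearDial.frobStructureLawOdd_holds`).

Tree twin, part C of 5, of the decomp-qadv lens-6 g23 node «TransferDial» (`Theses/TransferDial.lean` rev 3, sha256
1b7fda5a…95ba; declaration bodies copied verbatim, namespace `…Theses.TransferDial` ↦ `…Theorems.TransferDial`).
Residual mode beneath `Theses.CharDial.FrobLiftOdd` (stmt 32599): the target `StructureLawTwoOdd` = lens-6 g20 piece B.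
0 sorry; no `instance`, no `notation`, no `native_decide`.
-/

set_option autoImplicit false
set_option linter.dupNamespace false

namespace Summit.QuantumAdvantage.QuantumAdvantage.Theorems.TransferDial

open Classical
open Finset Module
open Summit.QuantumAdvantage.AdviceFreeQNC0
open Literature.Computability.MetaComplexity Literature.Computability.MetaComplexity.Smolensky

/-! ## §0 The two parents, verbatim -/

/-- TARGET — lens-6 g20 piece B, VERBATIM `Theses.FormReach.StructureLawTwoOdd` (HOME/decomp-qadv-lens-6/g20/FormReach.lean): every cut of
`𝔽_p`-degree `≤ 2p − 3` is a function of `K(p)` linear forms `u ↦ Σᵢ [uᵢ]·λ_{j,i}` over `𝔽_p`. -/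
def StructureLawTwoOdd : Prop :=
  ∀ (p : ℕ) [Fact p.Prime], 5 ≤ p → ∃ K : ℕ, ∀ (m : ℕ) (f : (Fin m → Bool) → Bool), HasDegF p f (2 * p - 3) →
    ∃ lam : Fin K → Fin m → ZMod p, ∃ F : (Fin K → ZMod p) → Bool,
      ∀ u, f u = F (fun j => ∑ i, if u i = true then lam j i else 0)


/-- PF — VERBATIM g21 `Theses.AscentDial.FieldCorePerPrime` (PROVED ON PAPER in g22 «ProbeDial», NODE-g22 rev2 §1, cond. BFHHL13
[arXiv:1212.3849, Lem 2.26 / Lem 3.2 / Thm 3.10 / Rem 2.9] + Assmus–Key Thm 5.7.9; critic 67v77/67v78 CLEARED): for each prime `p ≥ 5`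
plane-divisible point sets are cylinders over boundedly many coordinates. -/
def FieldCorePerPrime : Prop :=
  ∀ (p : ℕ) [Fact p.Prime], 5 ≤ p → ∃ K : ℕ, ∀ (n : ℕ) (W : Submodule (ZMod p) (Fin n → ZMod p))
    (S : Finset (Fin n → ZMod p)), PlaneDivIn W S → CylRankLe W S K

/-! ## §1 The residual and its costumes (typed) -/

/-- Coordinates `i, j` are EXCHANGEABLE for `f`: `f` is invariant under the transposition `(i j)` (= `IslandDial.Exch f {i,j}`). -/
def Sw {m : ℕ} (f : (Fin m → Bool) → Bool) (i j : Fin m) : Prop :=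
  ∀ u : Fin m → Bool, f (u ∘ Equiv.swap i j) = f u

/-- FEW TYPES at degree `d` with `N` colours: some `N`-colouring of the coordinates has «same colour ⟹ exchangeable». -/
def FewTypesAt (p : ℕ) [Fact p.Prime] (d N : ℕ) : Prop :=
  ∀ (m : ℕ) (f : (Fin m → Bool) → Bool), HasDegF p f d → ∃ c : Fin m → Fin N, ∀ i j, c i = c j → Sw f i j

/-- ★ THE RESIDUAL `FewTypesTwoOdd`: for every prime `p ≥ 5` the exchangeability relation of a cut of degree `≤ 2p − 3` has `≤ N(p)` classes. -/
def FewTypesTwoOdd : Prop := ∀ (p : ℕ) [Fact p.Prime], 5 ≤ p → ∃ N : ℕ, FewTypesAt p (2 * p - 3) N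

/-- The DEGREE LADDER: rung `t` = few types at degree `p − 1 + t` (primes `p ≥ t + 2`, so that `p − 1 + t ≤ 2p − 3`).
Rung 0 = degree `p − 1` (item 27205, CLOSED: `rung_zero`); rung 1 = degree `p`, the first open rung; `t = p − 2` is the residual. -/
def FewTypesRung (t : ℕ) : Prop :=
  ∀ (p : ℕ) [Fact p.Prime], 5 ≤ p → t + 2 ≤ p → ∃ N : ℕ, FewTypesAt p (p - 1 + t) N

/-- PARTNERS at degree `d` with exception budget `N₀`: all but `≤ N₀` coordinates have `≥ 3p − 2` exchange partners. -/
def PartnersAt (p : ℕ) [Fact p.Prime] (d N₀ : ℕ) : Prop :=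
  ∀ (m : ℕ) (f : (Fin m → Bool) → Bool), HasDegF p f d → ∃ L : Finset (Fin m), L.card ≤ N₀ ∧
    ∀ i ∉ L, 3 * p - 2 ≤ (univ.filter fun j : Fin m => j ≠ i ∧ Sw f i j).card

/-- ★ THE LOCAL FORM `PartnersTwoOdd` (OPEN, IDEA-NEEDED): at degree `≤ 2p − 3` all but boundedly many coordinates have `≥ 3p − 2`
exchange partners.  `FewTypes ⟹ Partners` is kernel (`partners_of_fewTypes`); the converse is `LocalToGlobalTwoOdd` (kernel ⟸ PF). -/
def PartnersTwoOdd : Prop := ∀ (p : ℕ) [Fact p.Prime], 5 ≤ p → ∃ N₀ : ℕ, PartnersAt p (2 * p - 3) N₀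

/-- LOCAL-TO-GLOBAL (pointwise in `f`; KERNEL from PF: `localToGlobal_of_transfer` + `transferOfFieldCore_holds`): if all but `≤ j` coordinates of a cut of degree `≤ 2p − 3`
have `≥ 3p − 2` exchange partners, the cut has `≤ N(p, j)` types. -/
def LocalToGlobalTwoOdd : Prop :=
  ∀ (p : ℕ) [Fact p.Prime], 5 ≤ p → ∀ j : ℕ, ∃ N : ℕ, ∀ (m : ℕ) (f : (Fin m → Bool) → Bool), HasDegF p f (2 * p - 3) →
    ∀ L : Finset (Fin m), L.card ≤ j → (∀ i ∉ L, 3 * p - 2 ≤ (univ.filter fun k : Fin m => k ≠ i ∧ Sw f i k).card) →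
    ∃ c : Fin m → Fin N, ∀ i k, c i = c k → Sw f i k

/-- FORMS-FROM-FEW (pointwise in `f`; KERNEL from PF: `formsFromFew_of_transfer` + `transferOfFieldCore_holds`): a cut of degree `≤ 2p − 3` with `≤ N` types is a function of
`≤ K(p, N)` linear forms. -/
def FormsFromFewTwoOdd : Prop :=
  ∀ (p : ℕ) [Fact p.Prime], 5 ≤ p → ∀ N : ℕ, ∃ K : ℕ, ∀ (m : ℕ) (f : (Fin m → Bool) → Bool), HasDegF p f (2 * p - 3) →
    (∃ c : Fin m → Fin N, ∀ i j, c i = c j → Sw f i j) →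
    ∃ lam : Fin K → Fin m → ZMod p, ∃ F : (Fin K → ZMod p) → Bool, ∀ u, f u = F (fun j => ∑ i, if u i = true then lam j i else 0)

/-- THE TRANSFER LEMMA (pointwise; KERNEL from PF: `transferOfFieldCore_holds`; both pointwise upgrades reduce to it): a cut of degree
`≤ 2p − 3` that is symmetric inside each USED block of a block map `b : Fin m → Option (Fin r)` (value `none` = the free part, `≤ j`
coordinates; every used block has `≥ 3p − 1` members; `r` ARBITRARY) is a function of `≤ K(p, j)` linear forms. -/
def TransferTwoOdd : Prop :=
  ∀ (p : ℕ) [Fact p.Prime], 5 ≤ p → ∀ j : ℕ, ∃ K : ℕ, ∀ (m r : ℕ) (f : (Fin m → Bool) → Bool) (b : Fin m → Option (Fin r)),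
    HasDegF p f (2 * p - 3) → (univ.filter fun i : Fin m => b i = none).card ≤ j →
    (∀ i k, b i = b k → b i ≠ none → Sw f i k) →
    (∀ i, b i ≠ none → 3 * p - 1 ≤ (univ.filter fun k : Fin m => b k = b i).card) →
    ∃ lam : Fin K → Fin m → ZMod p, ∃ F : (Fin K → ZMod p) → Bool, ∀ u, f u = F (fun q => ∑ i, if u i = true then lam q i else 0)


/-- The junction «field core ⟹ transfer lemma» as ONE named proposition (PROVED: `transferOfFieldCore_holds`, part E). -/
def TransferOfFieldCore : Prop := FieldCorePerPrime → TransferTwoOdd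

/-! ## §2 Kernel junctions -/

section Kernel
variable {p : ℕ} [Fact p.Prime]

/-- A linear form `Σᵢ [uᵢ] aᵢ` is invariant under swapping two coordinates with equal coefficients. -/
theorem linForm_swap {m : ℕ} (a : Fin m → ZMod p) {i j : Fin m} (hij : a i = a j) (u : Fin m → Bool) :
    (∑ k, if (u ∘ Equiv.swap i j) k = true then a k else 0) = ∑ k, if u k = true then a k else 0 := by
  have h1 : ∀ k, a (Equiv.swap i j k) = a k := by
    intro k
    by_cases hki : k = i
    · subst hki; rw [Equiv.swap_apply_left, hij]
    · by_cases hkj : k = j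
      · subst hkj; rw [Equiv.swap_apply_right, hij]
      · rw [Equiv.swap_apply_of_ne_of_ne hki hkj]
  have h2 : (∑ k, if (u ∘ Equiv.swap i j) k = true then a k else 0)
      = ∑ k, if (u ∘ Equiv.swap i j) k = true then a (Equiv.swap i j (Equiv.swap i j k)) else 0 :=
    Finset.sum_congr rfl fun k _ => by rw [Equiv.swap_apply_self]
  rw [h2]
  exact (Equiv.sum_comp (Equiv.swap i j) (fun l => if u l = true then a (Equiv.swap i j l) else 0)).trans
    (Finset.sum_congr rfl fun l _ => by rw [h1])

/-- COLUMN TYPING: a function of `K` linear forms has `≤ p^K` types (coordinates with equal coefficient columns are exchangeable). -/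
theorem fewTypes_of_forms {m K : ℕ} (f : (Fin m → Bool) → Bool)
    (lam : Fin K → Fin m → ZMod p) (F : (Fin K → ZMod p) → Bool)
    (hF : ∀ u, f u = F (fun j => ∑ i, if u i = true then lam j i else 0)) :
    ∃ c : Fin m → Fin (p ^ K), ∀ i j, c i = c j → Sw f i j := by
  have hcard : Fintype.card (Fin K → ZMod p) = p ^ K := by simp [ZMod.card]
  let e : (Fin K → ZMod p) ≃ Fin (p ^ K) := Fintype.equivFinOfCardEq hcard
  refine ⟨fun i => e (fun k => lam k i), fun i j hij u => ?_⟩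
  have hcol : (fun k => lam k i) = (fun k => lam k j) := e.injective hij
  rw [hF, hF]
  congr 1
  funext k
  exact linForm_swap (lam k) (congrFun hcol k) u

/-- ★ B ⟹ FewTypes (the residual is WEAKER than the target; kernel). -/
theorem fewTypes_of_structureLaw (hB : StructureLawTwoOdd) : FewTypesTwoOdd := by
  intro p _ hp
  obtain ⟨K, hK⟩ := hB p hp
  refine ⟨p ^ K, fun m f hf => ?_⟩
  obtain ⟨lam, F, hF⟩ := hK m f hf
  exact fewTypes_of_forms f lam F hF

/-- FewTypes ⟹ Partners at any degree, budget `N·(3p − 2)` (coordinates in small colour classes are the exceptions; kernel). -/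
theorem partnersAt_of_fewTypesAt {d N : ℕ} (h : FewTypesAt p d N) : PartnersAt p d (N * (3 * p - 2)) := by
  intro m f hf
  obtain ⟨c, hc⟩ := h m f hf
  let fib : Fin m → Finset (Fin m) := fun i => univ.filter fun j => c j = c i
  set L : Finset (Fin m) := univ.filter fun i : Fin m => (fib i).card ≤ 3 * p - 2 with hL
  refine ⟨L, ?_, ?_⟩
  · have hmap : ∀ i ∈ L, c i ∈ (univ : Finset (Fin N)) := fun _ _ => mem_univ _
    rw [Finset.card_eq_sum_card_fiberwise hmap]
    calc ∑ b ∈ (univ : Finset (Fin N)), (L.filter fun i => c i = b).card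
        ≤ ∑ b ∈ (univ : Finset (Fin N)), (3 * p - 2) := Finset.sum_le_sum fun b _ => ?_
      _ = N * (3 * p - 2) := by simp
    by_cases hne : (L.filter fun i => c i = b).Nonempty
    · obtain ⟨i, hi⟩ := hne
      rw [mem_filter] at hi
      have hiL : i ∈ L := hi.1
      rw [hL, mem_filter] at hiL
      calc (L.filter fun i => c i = b).card ≤ (fib i).card := card_le_card fun j hj => by
              rw [mem_filter] at hj
              simp only [fib, mem_filter, mem_univ, true_and]
              rw [hj.2, hi.2]
        _ ≤ 3 * p - 2 := hiL.2
    · rw [not_nonempty_iff_eq_empty.1 hne, card_empty]; exact Nat.zero_le _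
  · intro i hi
    have hbig : 3 * p - 2 < (fib i).card := by
      by_contra hle
      exact hi (by rw [hL, mem_filter]; exact ⟨mem_univ _, not_lt.1 hle⟩)
    have hmem : i ∈ fib i := by simp [fib]
    calc 3 * p - 2 ≤ (fib i).card - 1 := by omega
      _ = ((fib i).erase i).card := (card_erase_of_mem hmem).symm
      _ ≤ _ := card_le_card fun j hj => by
          rw [mem_erase] at hj
          simp only [fib, mem_filter, mem_univ, true_and] at hj
          exact mem_filter.2 ⟨mem_univ _, hj.1, hc i j hj.2.symm⟩

/-- ★ FewTypes ⟹ Partners (the local form is WEAKER than the residual; kernel). -/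
theorem partners_of_fewTypes (h : FewTypesTwoOdd) : PartnersTwoOdd := by
  intro p _ hp
  obtain ⟨N, hN⟩ := h p hp
  exact ⟨N * (3 * p - 2), partnersAt_of_fewTypesAt hN⟩

/-- B ⟹ FormsFromFew (trivially: the hypothesis is ignored; kernel — FormsFromFew is WEAKER than the target). -/
theorem formsFromFew_of_structureLaw (hB : StructureLawTwoOdd) : FormsFromFewTwoOdd := by
  intro p _ hp N
  obtain ⟨K, hK⟩ := hB p hp
  exact ⟨K, fun m f hf _ => hK m f hf⟩

/-- FewTypes ⟹ LocalToGlobal (trivially; kernel — LocalToGlobal is WEAKER than the residual). -/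
theorem localToGlobal_of_fewTypes (h : FewTypesTwoOdd) : LocalToGlobalTwoOdd := by
  intro p _ hp j
  obtain ⟨N, hN⟩ := h p hp
  exact ⟨N, fun m f hf _ _ _ => hN m f hf⟩

/-- ★ GLUE 1 (kernel): FewTypes ⟸ LocalToGlobal ∧ Partners. -/
theorem fewTypes_of_localToGlobal_partners (hL : LocalToGlobalTwoOdd) (hP : PartnersTwoOdd) : FewTypesTwoOdd := by
  intro p _ hp
  obtain ⟨N₀, hN₀⟩ := hP p hp
  obtain ⟨N, hN⟩ := hL p hp N₀
  refine ⟨N, fun m f hf => ?_⟩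
  obtain ⟨L, hLc, hLp⟩ := hN₀ m f hf
  exact hN m f hf L hLc hLp

/-- ★ GLUE 2 (kernel): B ⟸ FormsFromFew ∧ FewTypes. -/
theorem structureLaw_of_formsFromFew_fewTypes (hF : FormsFromFewTwoOdd) (hT : FewTypesTwoOdd) : StructureLawTwoOdd := by
  intro p _ hp
  obtain ⟨N, hN⟩ := hT p hp
  obtain ⟨K, hK⟩ := hF p hp N
  exact ⟨K, fun m f hf => hK m f hf (hN m f hf)⟩

/-- ★★ THE NODE'S DECIDING IMPLICATION (kernel skeleton): B ⟸ FormsFromFew ∧ LocalToGlobal ∧ Partners — the first two PAPER ⟸ PF,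
the third the OPEN residual. -/
theorem closes (hF : FormsFromFewTwoOdd) (hL : LocalToGlobalTwoOdd) (hP : PartnersTwoOdd) : StructureLawTwoOdd :=
  structureLaw_of_formsFromFew_fewTypes hF (fewTypes_of_localToGlobal_partners hL hP)

/-- … and conversely every binder of `closes` follows from B (kernel): the carving is EXACT. -/
theorem pieces_of_structureLaw (hB : StructureLawTwoOdd) :
    FormsFromFewTwoOdd ∧ LocalToGlobalTwoOdd ∧ PartnersTwoOdd :=
  ⟨formsFromFew_of_structureLaw hB, localToGlobal_of_fewTypes (fewTypes_of_structureLaw hB),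
    partners_of_fewTypes (fewTypes_of_structureLaw hB)⟩


/-! ### the degree ladder -/

/-- Few types is monotone in the degree (a degree-`d` cut is a degree-`d'` cut). -/
theorem fewTypesAt_mono {d d' N : ℕ} (hdd : d ≤ d') (h : FewTypesAt p d' N) : FewTypesAt p d N :=
  fun m f hf => h m f (lowDeg_mono hdd hf)

end Kernel

/-- The residual implies every rung. -/
theorem rung_of_fewTypesTwoOdd (h : FewTypesTwoOdd) (t : ℕ) : FewTypesRung t := by
  intro p _ hp ht
  obtain ⟨N, hN⟩ := h p hp
  exact ⟨N, fewTypesAt_mono (by omega) hN⟩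

/-- All rungs give the residual (rung `t = p − 2` at the prime `p`). -/
theorem fewTypesTwoOdd_of_rungs (h : ∀ t, FewTypesRung t) : FewTypesTwoOdd := by
  intro p _ hp
  obtain ⟨N, hN⟩ := h (p - 2) p hp (by omega)
  have e : 2 * p - 3 = p - 1 + (p - 2) := by omega
  exact ⟨N, by rw [e]; exact hN⟩

section RungZero
variable {p : ℕ} [Fact p.Prime]

/-- The normal form of law 2½ (`h(u|_J, Σᵢ[uᵢ]aᵢ)`, `|J| ≤ J₀`) has `≤ J₀ + p` types: the junta coordinates one colour each, the
others coloured by their coefficient. -/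
theorem fewTypes_of_normalForm {m J₀ : ℕ} (f : (Fin m → Bool) → Bool) (J : Finset (Fin m)) (hJ : J.card ≤ J₀)
    (a : Fin m → ZMod p) (h : (Fin m → Bool) → ZMod p → Bool)
    (hdep : ∀ u v : Fin m → Bool, (∀ i ∈ J, u i = v i) → ∀ s, h u s = h v s)
    (hf : ∀ u, f u = h u (∑ i, if u i = true then a i else 0)) :
    ∃ c : Fin m → Fin (J₀ + p), ∀ i j, c i = c j → Sw f i j := by
  let ι := {x // x ∈ J} ⊕ ZMod p
  have hι : Fintype.card ι ≤ J₀ + p := by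
    simp only [ι, Fintype.card_sum, Fintype.card_coe, ZMod.card]; omega
  let emb : ι ↪ Fin (J₀ + p) := (Fintype.equivFin ι).toEmbedding.trans (Fin.castLEEmb hι)
  let c₀ : Fin m → ι := fun i => if hi : i ∈ J then Sum.inl ⟨i, hi⟩ else Sum.inr (a i)
  refine ⟨fun i => emb (c₀ i), fun i j hij u => ?_⟩
  have h0 : c₀ i = c₀ j := emb.injective hij
  by_cases hi : i ∈ J
  · have hci : c₀ i = Sum.inl ⟨i, hi⟩ := by simp only [c₀, dif_pos hi]
    by_cases hj : j ∈ J
    · have hcj : c₀ j = Sum.inl ⟨j, hj⟩ := by simp only [c₀, dif_pos hj]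
      rw [hci, hcj] at h0
      have hij' : i = j := congrArg Subtype.val (Sum.inl_injective h0)
      subst hij'
      simp [Equiv.swap_self]
    · have hcj : c₀ j = Sum.inr (a j) := by simp only [c₀, dif_neg hj]
      rw [hci, hcj] at h0
      exact absurd h0 Sum.inl_ne_inr
  · have hci : c₀ i = Sum.inr (a i) := by simp only [c₀, dif_neg hi]
    by_cases hj : j ∈ J
    · have hcj : c₀ j = Sum.inl ⟨j, hj⟩ := by simp only [c₀, dif_pos hj]
      rw [hci, hcj] at h0
      exact absurd h0 Sum.inr_ne_inl
    · have hcj : c₀ j = Sum.inr (a j) := by simp only [c₀, dif_neg hj]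
      rw [hci, hcj] at h0
      have ha : a i = a j := Sum.inr_injective h0
      rw [hf, hf, linForm_swap a ha u]
      refine hdep _ _ (fun k hk => ?_) _
      have hki : k ≠ i := fun e => hi (e ▸ hk)
      have hkj : k ≠ j := fun e => hj (e ▸ hk)
      simp only [Function.comp_apply, Equiv.swap_apply_of_ne_of_ne hki hkj]

/-- Rung 0 ⟸ the Frobenius-degree structure law `CharDial.FrobStructureLawOdd` (item 27205). -/
theorem rung_zero_of_frob (h : Summit.QuantumAdvantage.QuantumAdvantage.Theses.CharDial.FrobStructureLawOdd) :
    FewTypesRung 0 := by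
  intro p _ hp _
  obtain ⟨J₀, hJ₀⟩ := h p hp
  refine ⟨J₀ + p, fun m f hf => ?_⟩
  obtain ⟨J, hJ, a, hh, hdep, hfu⟩ := hJ₀ m f hf
  exact fewTypes_of_normalForm f J hJ a hh hdep hfu

end RungZero

/-- ★ RUNG 0 HOLDS (kernel, unconditional): 27205 is CLOSED in the tree (`ShearDial.frobStructureLawOdd_holds`). -/
theorem rung_zero : FewTypesRung 0 :=
  rung_zero_of_frob Summit.QuantumAdvantage.QuantumAdvantage.Theorems.ShearDial.frobStructureLawOdd_holds

end Summit.QuantumAdvantage.QuantumAdvantage.Theorems.TransferDial
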